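import Summits.QuantumFields.BalabanUV.T4Continuum.Support.AveragingDeficitChartCalculus

/-!
# AveragingDeficitFermat (T⁴ programme, node NE3, row NE3-R2, gen 3) — R0 OF THE NE3 ENERGY ROUTE: FERMAT ON THE
# COMPOSITE-CONSTRAINT MANIFOLD FOR BAŁABAN'S NON-LINEAR AVERAGE (42) — the hypothesis shape `FineCritical` of gen 2's
# `dualResidual_torus` is a THEOREM for constrained minimisers of the fine Wilson action (file 3/3)

HONEST FRAMING (cell `pub-balaban`, T4-DAG PAGE 1; unit `b2b-balaban-t4-ne3r2-p1` = owner of BINDER-OWNERS row NE3-R2,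
gen 3).  The cell's T4 target is the finite-torus continuum limit of the unit-scale averaged loop expectations — NOT
infinite volume, NO mass gap, NOT Clay, NOT summit progress.  On the energy route NE3(A) ⇐ ML ∧ R0 ∧ β ∧ γ
(record `t4/T4-EST-NE3-P2.md` §0 (e)).  Gen 2 proved β (β-per), the residual pairing and the lift (γ1), and assembled
R2ᴱ on the torus (`AveragingDeficitDualResidual.dualResidual_torus`) MODULO the hypothesis shape `FineCritical L M V Tc`
— «the constrained minimiser is critical for the fine action along every periodic face-supported `𝔲(N)` direction whose
push-forward is an admissible coarse direction» (item R0, the Fermat/admissibility locus of B11 (82)–(84)).  THIS FILE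
PROVES R0, all [folklore], 0 sorry:
§1 `fermat_of_submersion` — Fermat's theorem on a level set `{f = f x₀}` of a strictly differentiable map with
SURJECTIVE differential: a local minimiser of `φ` has `Dφ(x₀) = 0` on `ker Df(x₀)` (from Mathlib's Lagrange
multipliers `IsLocalExtrOn.exists_linear_map_of_hasStrictFDerivAt`; no printed input);
§2 periodicity of the average (42) along period-lattice vectors (`hol_add_smul`, `bavg_add_smul`, `cavg_add_smul`,
`isPeriodicCfg_cavg`) and **`eventually_smallField_chart`** (the small-field region `|U(∂p) − 1| ≤ b`, `b > a`, is a
neighbourhood of `V` in the chart: finitely many plaquettes per period, each continuous in the chart parameter);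
§3 `small512_of_liftSmall`; **`eventually_cavg_chart_eq`** (near `0` the average of the chart IS the coarse chart of its
coordinates: `cavg (chart ψ) = chart_id (cavg V) (coord ψ)`, by the tree's `exp_mlog`); and THE THEOREM
**`fineCritical_of_isMinOn`**: for a `U(N)`-valued `V` of period `L·M` with `|V(∂p) − 1| ≤ a`, `liftSmall d L·a ≤ 1`,
minimising the fine Wilson action of the period among unitary `L·M`-periodic `U` with `|U(∂p) − 1| ≤ b` (`a < b`) under
a constraint `Q(cavg L U) = Q(cavg L V)` imposed THROUGH THE AVERAGE — `Q` any map of the averaged configuration (read on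
the coarse unit lattice, `cavg`) into a complete normed space, strictly differentiable at `cavg L V` in the exponential
chart of the coarse torus with differential `Q′` ONTO from the `𝔲(N)` directions (dictionary: the further averaging
steps of the composite constraint `Q̄_k(Ū) = V_top`) — `FineCritical L M V (fun φ ↦ Q′(res φ) = 0)` HOLDS.  Mechanism:
`f := Q ∘ cavg ∘ chart` is strictly differentiable at `0` with `Df(0) = Q′ ∘ D coord(0) = Q′ ∘ pushDir`
(`AveragingDeficitChartCalculus.fderiv_coord_apply`) and ONTO by gen 2's periodic lift `exists_lift_periodic`
(the submersion (γ1)); the minimiser is a local minimiser of the smooth chart action on `{f = f 0}`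
(`eventually_smallField_chart`, `isUnitaryCfg_chart`, `isPeriodicCfg_chart`); `fermat_of_submersion`; and the Fréchet
derivative of the chart action along `res ψ` is the derivative of the fine action along `vary V ψ`
(`hasDerivAt_fineAction_chartDir`, `chartDir_skewP_resDir`);
§4 **`dualResidual_minimiser`**, `dualResidual_minimiser_l2` — gen 2's R2ᴱ on the torus with the criticality hypothesis
DISCHARGED: the coarse residual current of the average of an ACTUAL constrained minimiser is bounded against every
periodic coarse `𝔲(N)` direction tangent to the constraint, in the dual `ℓ²`/`ℓ¹` norms, with gen 2's constants.
WHAT REMAINS on the energy route (row NE3's business): ML (tangent coercivity), (γ2)–(γ4) (energy-norm cost of the lift via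
the gauge condition (76)), the δ-dictionary; and the INSTANCE of `Q` for Bałaban's composite constraint (the next averaging
steps in their charts — the same calculus one level up; existence of the minimiser is by compactness and not needed here).
NE3 ITSELF IS NOT PROVED; NE3 stays COND-free.
CITATION HEADER: no printed sentence is a hypothesis; the manuscripts under audit are not cited for any disputed step;
context: T. Bałaban, Commun. Math. Phys. **98** (1985) 17–51 [Balaban1985Averaging] ((42) p. 23, (44) p. 24);
**102** (1985) 277–309 [Balaban1985Variational] ((5) p. 278, (26)–(27) p. 282, (75)–(77) p. 289, (82)–(84) p. 290,
§E (115)–(121) p. 295 — the constrained minimisers `U_k(V)` and their first-variation equations).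
PLACEMENT: `Summits/QuantumFields/BalabanUV/` (human rule 2026-08-19).  Record: HOME `t4/T4-EST-NE3-R2.md` v0.4.
-/

set_option autoImplicit false

open scoped BigOperators Matrix Matrix.Norms.L2Operator Topology
open NormedSpace Finset Filter

namespace Summit.QuantumFields.BalabanUV.T4Continuum.AveragingDeficitFermat

open Literature.MathematicalPhysics.QuantumFieldTheory.Balaban1983to89
open B7Prop1Explicit B7Prop2Explicit MatrixLog UnitaryModel
open T4AveragingDeficitWall hiding Site Plane Plaq Bond
open T4AveragingDeficitWallBoundary (IsPeriodicCfg periodBox)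
open T4AveragingDeficitNonAbelian (hol_add_period)
open AveragingDeficitTransport AveragingDeficitPlaqDeriv AveragingDeficitSideDeriv AveragingDeficitPeriodicCounting
open AveragingDeficitDerivWallProof AveragingDeficitResidualPairing AveragingDeficitFaceWords AveragingDeficitFaceLift
open AveragingDeficitLiftPeriodic
open AveragingDeficitDualResidual AveragingDeficitTorusChart AveragingDeficitChartCalculus

noncomputable section

variable {d : ℕ} {n : Type*} [Fintype n] [DecidableEq n]

local notation "𝕄" => Matrix n n ℂ
local notation "Site" => B7Prop1Explicit.Site

/-! ## §1 Fermat's theorem under a submersive constraint (from Mathlib's Lagrange multipliers) -/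

/-- **FERMAT ON A CONSTRAINT MANIFOLD**: if `x₀` is a local minimum of `φ` on the level set `{f = f x₀}` of a map that is
strictly differentiable at `x₀` with SURJECTIVE differential, then `Dφ(x₀)` vanishes on `ker Df(x₀)` (Lagrange: a
non-trivial pair `(Λ, Λ₀)` with `Λ ∘ Df + Λ₀ Dφ = 0`; `Λ₀ = 0` would force `Λ ∘ Df = 0`, i.e. `Λ = 0`). [folklore] -/
theorem fermat_of_submersion {E F : Type*} [NormedAddCommGroup E] [NormedSpace ℝ E] [CompleteSpace E]
    [NormedAddCommGroup F] [NormedSpace ℝ F] [CompleteSpace F] {f : E → F} {φ : E → ℝ} {x₀ : E}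
    {f' : E →L[ℝ] F} {φ' : E →L[ℝ] ℝ} (hmin : IsLocalMinOn φ {x | f x = f x₀} x₀)
    (hf : HasStrictFDerivAt f f' x₀) (hφ : HasStrictFDerivAt φ φ' x₀) (hsurj : Function.Surjective f')
    {v : E} (hv : f' v = 0) : φ' v = 0 := by
  obtain ⟨Λ, Λ₀, hne, hΛ⟩ := IsLocalExtrOn.exists_linear_map_of_hasStrictFDerivAt hmin.isExtr hf hφ
  have hvΛ := hΛ v
  rw [hv, map_zero, zero_add, smul_eq_mul] at hvΛ
  rcases mul_eq_zero.mp hvΛ with h0 | h0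
  · exfalso
    apply hne
    have hΛ0 : Λ = 0 := by
      refine LinearMap.ext fun y => ?_
      obtain ⟨x, rfl⟩ := hsurj y
      have := hΛ x
      rw [h0, zero_smul, add_zero] at this
      simpa using this
    rw [hΛ0, h0]
    rfl
  · exact h0

/-! ## §2 Periodicity of the average along period-lattice vectors; the small-field class is open in the chart -/

/-- Transport (9) of a periodic configuration is periodic in the base point along every period-lattice vector. [folklore] -/
theorem hol_add_smul {U : Site d → Fin d → 𝕄ˣ} {Pe : ℤ} (hU : IsPeriodicCfg U Pe) (x k : Site d) (w : List (Letter d)) :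
    hol U (x + Pe • k) w = hol U x w :=
  periodic_smul_vec (f := fun y => hol U y w) (fun y κ => hol_add_period hU κ w y) x k

/-- The average (42) of a periodic configuration is periodic along every period-lattice vector. [cite: Balaban1985Averaging, (42) p.23] -/
theorem bavg_add_smul (L : ℕ) {U : Site d → Fin d → 𝕄ˣ} {Pe : ℤ} (hU : IsPeriodicCfg U Pe) (q k : Site d) (κ : Fin d) :
    bavg L U (q + Pe • k) κ = bavg L U q κ := by
  simp only [bavg, Xavg, Wcx, hol_add_smul hU]

/-- The coarse-unit-lattice reading of the average of an `L·M`-periodic configuration is `M`-periodic along every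
lattice vector. [folklore] -/
theorem cavg_add_smul (L M : ℕ) {U : Site d → Fin d → 𝕄ˣ} (hU : IsPeriodicCfg U ((L : ℤ) * M)) (y k : Site d)
    (κ : Fin d) : cavg L U (y + (M : ℤ) • k) κ = cavg L U y κ := by
  simp only [cavg, smul_add, smul_smul]
  exact bavg_add_smul L hU _ k κ

/-- … in particular it is an `M`-periodic configuration. [folklore] -/
theorem isPeriodicCfg_cavg (L M : ℕ) {U : Site d → Fin d → 𝕄ˣ} (hU : IsPeriodicCfg U ((L : ℤ) * M)) :
    IsPeriodicCfg (cavg L U) (M : ℤ) := fun y κ μ => cavg_add_smul L M hU y (e κ) μ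

omit [Fintype n] [DecidableEq n] in
/-- The wrap of a site lies in the period box. [folklore] -/
theorem boxVec_redN_mem (N : ℕ) [NeZero N] (x : Site d) : boxVec N (redN N x) ∈ periodBox (d := d) N :=
  Finset.mem_image_of_mem _ (Finset.mem_univ _)

/-- **THE SMALL-FIELD CLASS IS OPEN IN THE CHART**: if the `N`-periodic `V` has all plaquette variables within `a` of `1`
and `a < b`, then for all chart parameters near `0` the configuration `chart P N V ψ` has all plaquette variables within
`b` of `1` (finitely many plaquettes per period, each continuous in `ψ`). [folklore] -/
theorem eventually_smallField_chart (P : 𝕄 →L[ℝ] 𝕄) (N : ℕ) [NeZero N] {V : Site d → Fin d → 𝕄ˣ}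
    (hVP : IsPeriodicCfg V (N : ℤ)) {a b : ℝ} (hab : a < b) (hVa : SmallField V a) :
    ∀ᶠ ψ in 𝓝 (0 : TDir d n N), SmallField (chart P N V ψ) b := by
  -- finitely many plaquette variables per period, each continuous in `ψ`
  have hfin : ∀ᶠ ψ in 𝓝 (0 : TDir d n N), ∀ x ∈ periodBox (d := d) N, ∀ κκ' : Fin d × Fin d, κκ'.1 ≠ κκ'.2 →
      ‖((hol (chart P N V ψ) x (plaqWord κκ'.1 κκ'.2) : 𝕄ˣ) : 𝕄) - 1‖ < b := by
    refine (Finset.eventually_all _).mpr fun x _ => Filter.eventually_all.mpr fun κκ' => ?_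
    by_cases hκ : κκ'.1 = κκ'.2
    · exact Filter.Eventually.of_forall fun _ h => absurd hκ h
    have hc : ContinuousAt (fun ψ : TDir d n N => ‖((hol (chart P N V ψ) x (plaqWord κκ'.1 κκ'.2) : 𝕄ˣ) : 𝕄) - 1‖)
        0 :=
      ((contDiffAt_val_hol_chart (m := 0) P N V 0 _ x).continuousAt.sub continuousAt_const).norm
    have h0 : ‖((hol (chart P N V 0) x (plaqWord κκ'.1 κκ'.2) : 𝕄ˣ) : 𝕄) - 1‖ < b := by
      rw [chart_zero]
      exact (hVa x κκ'.1 κκ'.2 hκ).trans_lt hab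
    exact (hc.eventually (gt_mem_nhds h0)).mono fun ψ h _ => h
  refine hfin.mono fun ψ hψ x κ κ' hκ => ?_
  -- reduce the base point to the period box
  have hper : IsPeriodicCfg (chart P N V ψ) (N : ℤ) := isPeriodicCfg_chart P N hVP ψ
  rw [eq_wrap_add N x, hol_add_smul hper]
  exact (hψ _ (boxVec_redN_mem N x) (κ, κ') hκ).le

/-! ## §3 R0: fine criticality of constrained minimisers along lifted directions -/

/-- The B7 smallness `512(d+1)(d+4)L²·a ≤ 1` from the lift smallness `liftSmall d L·a ≤ 1`. [folklore] -/
theorem small512_of_liftSmall {L : ℕ} (hL : 1 ≤ L) {a : ℝ} (ha : 0 ≤ a) (hsmall : liftSmall d L * a ≤ 1) :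
    512 * (d + 1) * (d + 4) * (L : ℝ) ^ 2 * a ≤ 1 := by
  have hL1 : (1 : ℝ) ≤ L := by exact_mod_cast hL
  have hLd : (1 : ℝ) ≤ (L : ℝ) ^ d := one_le_pow₀ hL1
  have hd0 : (0 : ℝ) ≤ d := Nat.cast_nonneg d
  unfold liftSmall at hsmall
  have hpow : (L : ℝ) ^ (d + 2) = (L : ℝ) ^ d * (L : ℝ) ^ 2 := by ring
  rw [hpow] at hsmall
  have : 512 * ((d : ℝ) + 1) * ((d : ℝ) + 4) * (L : ℝ) ^ 2 * a
      ≤ 32768 * ((d : ℝ) + 1) * ((d : ℝ) + 4) * ((L : ℝ) ^ d * (L : ℝ) ^ 2) * a := by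
    have h0 : 0 ≤ ((d : ℝ) + 1) * ((d : ℝ) + 4) * (L : ℝ) ^ 2 * a := by positivity
    nlinarith
  linarith

/-- **IN THE CHART, THE AVERAGE IS THE COARSE CHART OF ITS COORDINATES** (near `ψ = 0`): eventually
`cavg L (chart skewP (LM) V ψ) = chart id M (cavg L V) (coord skewP L M V ψ)` — `W₀·exp(log(W₀⁻¹W)) = W` by the tree's
`exp_mlog` once `W₀⁻¹W` is in the ball, which holds near `0` by continuity at the finitely many torus bonds and
everywhere by periodicity. [folklore] -/
theorem eventually_cavg_chart_eq [Nonempty n] {L M : ℕ} [NeZero M] [NeZero (L * M)] (hL : 1 ≤ L)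
    {V : Site d → Fin d → 𝕄ˣ} (hV : IsUnitaryCfg V) (hVP : IsPeriodicCfg V ((L : ℤ) * M)) {a : ℝ} (ha : 0 ≤ a)
    (h512 : 512 * (d + 1) * (d + 4) * (L : ℝ) ^ 2 * a ≤ 1) (hVa : SmallField V a) :
    ∀ᶠ ψ in 𝓝 (0 : TDir d n (L * M)),
      cavg L (chart skewP (L * M) V ψ) = chart (ContinuousLinearMap.id ℝ 𝕄) M (cavg L V) (coord skewP L M V ψ) := by
  have hW : ∀ (q : Site d) (κ : Fin d) (r : Fin d → Fin L), ‖((Wcx L V q κ (boxVec L r) : 𝕄ˣ) : 𝕄) - 1‖ < 1 :=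
    norm_Wcx_sub_one_lt_one_of_smallField L hL hV ha h512 hVa
  -- the ball condition at the finitely many torus bonds, eventually
  have hball : ∀ᶠ ψ in 𝓝 (0 : TDir d n (L * M)), ∀ rκ : (Fin d → Fin M) × Fin d,
      ‖(((cavg L V (boxVec M rκ.1) rκ.2)⁻¹ : 𝕄ˣ) : 𝕄)
          * ((cavg L (chart skewP (L * M) V ψ) (boxVec M rκ.1) rκ.2 : 𝕄ˣ) : 𝕄) - 1‖ < 1 := by
    refine Filter.eventually_all.mpr fun rκ => ?_
    have hc : ContinuousAt (fun ψ : TDir d n (L * M) => ‖(((cavg L V (boxVec M rκ.1) rκ.2)⁻¹ : 𝕄ˣ) : 𝕄)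
        * ((cavg L (chart skewP (L * M) V ψ) (boxVec M rκ.1) rκ.2 : 𝕄ˣ) : 𝕄) - 1‖) 0 := by
      refine ((continuousAt_const.mul ?_).sub continuousAt_const).norm
      exact (contDiffAt_val_bavg_chart (m := 0) skewP (L * M) V L _ rκ.2 0
        (by rw [chart_zero]; exact hW _ _)).continuousAt
    have h0 : ‖(((cavg L V (boxVec M rκ.1) rκ.2)⁻¹ : 𝕄ˣ) : 𝕄)
        * ((cavg L (chart skewP (L * M) V 0) (boxVec M rκ.1) rκ.2 : 𝕄ˣ) : 𝕄) - 1‖ < 1 := by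
      rw [chart_zero, Units.inv_mul, sub_self, norm_zero]
      exact one_pos
    exact hc.eventually (gt_mem_nhds h0)
  refine hball.mono fun ψ hψ => ?_
  have hperV : IsPeriodicCfg (cavg L V) (M : ℤ) := isPeriodicCfg_cavg L M hVP
  have hperU : IsPeriodicCfg (cavg L (chart skewP (L * M) V ψ)) (M : ℤ) :=
    isPeriodicCfg_cavg L M (by
      have h := isPeriodicCfg_chart skewP (L * M) (V := V) (by rw [natCast_mul_period]; exact hVP) ψ
      rw [natCast_mul_period] at h
      exact h)
  funext y κ
  apply Units.ext
  have hy := eq_wrap_add M y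
  set r := redN M y with hr
  have e1 : cavg L (chart skewP (L * M) V ψ) y κ = cavg L (chart skewP (L * M) V ψ) (boxVec M r) κ := by
    conv_lhs => rw [hy]
    exact periodic_smul_vec (f := fun z => cavg L (chart skewP (L * M) V ψ) z κ) (fun z i => hperU z i κ) _ _
  have e2 : cavg L V y κ = cavg L V (boxVec M r) κ := by
    conv_lhs => rw [hy]
    exact periodic_smul_vec (f := fun z => cavg L V z κ) (fun z i => hperV z i κ) _ _
  rw [e1]
  simp only [chart, chartDir, ContinuousLinearMap.id_apply, coord, relLog, Units.val_mul, val_expUnit, ← hr]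
  rw [exp_mlog (hψ (r, κ)), e2, ← mul_assoc, Units.mul_inv, one_mul]

/-- **R0 — FINE CRITICALITY OF CONSTRAINED LOCAL MINIMISERS ALONG LIFTED DIRECTIONS (Fermat on the
composite-constraint manifold for Bałaban's non-linear average), NEIGHBOURHOOD FORM.**  Let `V` be a `U(N)`-valued
configuration of period `L·M` in the small-field class `|V(∂p) − 1| ≤ a`, `liftSmall d L·a ≤ 1`, and let the CONSTRAINT
be imposed THROUGH the average: a map `Q` of the averaged configuration read on the coarse unit lattice (`cavg L U`),
strictly differentiable at `cavg L V` in the exponential chart `Φ ↦ (cavg L V)·e^{Φ}` of the coarse torus with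
differential `Q′` that is ONTO from the `𝔲(N)` directions (dictionary: `Q` = the further averaging steps of the composite
constraint `Q̄_k(Ū) = V_top`, or any submersive observable of `Ū`).  Let `Near` be any side condition holding for all
chart configurations `V e^{ψ}` with `ψ` near `0` (e.g. a small-field region `|U(∂p) − 1| ≤ b`, `b > a`:
`eventually_smallField_chart`).  If `V` MINIMISES the fine Wilson action of the period among the `U(N)`-valued
configurations `U` of period `L·M` with `Near U` that satisfy the constraint `Q(cavg L U) = Q(cavg L V)`, then `V` is
critical for the fine action along EVERY periodic face-supported `𝔲(N)` direction whose push-forward `φ` satisfies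
`Q′φ = 0` — i.e. `FineCritical L M V (Q′ ∘ res = 0)`, the hypothesis of `dualResidual_torus`.  Proof: Lagrange
multipliers on the finite torus chart (`fermat_of_submersion`) for `f = Q ∘ cavg ∘ chart` — strictly differentiable with
`Df(0) = Q′ ∘ D coord(0) = Q′ ∘ pushDir` (file 2/3) and onto by gen 2's periodic lift `exists_lift_periodic` — and
`φ = ` the chart action. [cite: Balaban1985Variational, (75)–(77) p.289, (82)–(84) p.290, §E (115)–(121) p.295] -/
theorem fineCritical_of_isLocalMin [Nonempty n] {L M : ℕ} [NeZero L] [NeZero M] {V : Site d → Fin d → 𝕄ˣ}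
    (hV : IsUnitaryCfg V) (hVP : IsPeriodicCfg V ((L : ℤ) * M)) {a : ℝ} (ha : 0 ≤ a)
    (hsmall : liftSmall d L * a ≤ 1) (hVa : SmallField V a)
    {G : Type*} [NormedAddCommGroup G] [NormedSpace ℝ G] [CompleteSpace G]
    (Q : (Site d → Fin d → 𝕄ˣ) → G) (Q' : TDir d n M →L[ℝ] G)
    (hQ : HasStrictFDerivAt (fun Φ : TDir d n M => Q (chart (ContinuousLinearMap.id ℝ 𝕄) M (cavg L V) Φ)) Q' 0)
    (hQ' : ∀ γ : G, ∃ Φ : TDir d n M, (∀ r κ, Φ r κ ∈ skewAdjoint 𝕄) ∧ Q' Φ = γ)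
    (Near : (Site d → Fin d → 𝕄ˣ) → Prop) (hNear : ∀ᶠ θ in 𝓝 (0 : TDir d n (L * M)), Near (chart skewP (L * M) V θ))
    (hmin : ∀ U : Site d → Fin d → 𝕄ˣ, IsUnitaryCfg U → IsPeriodicCfg U ((L : ℤ) * M) → Near U →
      Q (cavg L U) = Q (cavg L V) →
        fineAction V (blockWindow L (periodBox M)).2 ≤ fineAction U (blockWindow L (periodBox M)).2) :
    FineCritical L M V (fun φ => Q' (resDir M φ) = 0) := by
  have hL : 1 ≤ L := Nat.one_le_iff_ne_zero.mpr (NeZero.ne L)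
  have h512 : 512 * (d + 1) * (d + 4) * (L : ℝ) ^ 2 * a ≤ 1 := small512_of_liftSmall hL ha hsmall
  have hW : ∀ (q : Site d) (κ : Fin d) (r : Fin d → Fin L), ‖((Wcx L V q κ (boxVec L r) : 𝕄ˣ) : 𝕄) - 1‖ < 1 :=
    norm_Wcx_sub_one_lt_one_of_smallField L hL hV ha h512 hVa
  have hVP' : IsPeriodicCfg V ((L * M : ℕ) : ℤ) := by rw [natCast_mul_period]; exact hVP
  intro ψ hψs hψP hψF hTc
  set Wf := (blockWindow L (periodBox (d := d) M)).2 with hWf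
  -- the chart action and the chart constraint
  set A : TDir d n (L * M) → ℝ := fun θ => fineAction (chart skewP (L * M) V θ) Wf with hA
  set F : TDir d n (L * M) → G := fun θ => Q (cavg L (chart skewP (L * M) V θ)) with hF
  -- strict differentiability of the action
  have hAd : HasStrictFDerivAt A (fderiv ℝ A 0) 0 :=
    (contDiffAt_fineAction_chart (m := 1) skewP (L * M) V Wf 0).hasStrictFDerivAt one_ne_zero
  -- strict differentiability of the constraint: `F = Q ∘ chart_id ∘ coord` near `0`
  have hcoord : HasStrictFDerivAt (coord skewP L M V) (fderiv ℝ (coord skewP L M V) 0) 0 :=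
    (contDiffAt_coord (m := 1) skewP L M V hW).hasStrictFDerivAt one_ne_zero
  have hQ0 : HasStrictFDerivAt (fun Φ : TDir d n M => Q (chart (ContinuousLinearMap.id ℝ 𝕄) M (cavg L V) Φ)) Q'
      (coord skewP L M V 0) := by
    rw [coord_zero]; exact hQ
  have hFd : HasStrictFDerivAt F (Q'.comp (fderiv ℝ (coord skewP L M V) 0)) 0 := by
    refine (hQ0.comp 0 hcoord).congr_of_eventuallyEq ?_
    exact (eventually_cavg_chart_eq hL hV hVP ha h512 hVa).mono fun θ hθ => by
      simp only [hF, hθ]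
  -- the differential of the constraint is onto (the periodic lift)
  have hsurj : Function.Surjective (Q'.comp (fderiv ℝ (coord skewP L M V) 0)) := by
    intro γ
    obtain ⟨Φ, hΦs, hΦ⟩ := hQ' γ
    have hφP : ∀ (y : Site d) (j κ : Fin d), extDir M Φ (y + (M : ℤ) • e j) κ = extDir M Φ y κ :=
      fun y j κ => isPeriodicDir_extDir M Φ y j κ
    obtain ⟨χ, hχF, hχP, hχpush, -, hχs⟩ := exists_lift_periodic hL hV hVP ha hsmall hVa (extDir M Φ) hφP
    have hχskew : IsSkewDir χ := hχs fun y κ => hΦs _ _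
    have hχP' : IsPeriodicDir χ ((L * M : ℕ) : ℤ) := by rw [natCast_mul_period]; exact hχP
    refine ⟨resDir (L * M) χ, ?_⟩
    rw [ContinuousLinearMap.comp_apply, ← hΦ]
    congr 1
    funext r κ
    rw [fderiv_coord_apply skewP L M V hW, chartDir_skewP_resDir (L * M) hχP' hχskew, hχpush]
    simp only [extDir, redN_boxVec]
  -- the minimiser is a local minimiser in the chart
  have hloc : IsLocalMinOn A {θ | F θ = F 0} 0 := by
    refine eventually_nhdsWithin_iff.mpr (hNear.mono fun θ hθ hθF => ?_)
    simp only [Set.mem_setOf_eq, hF, chart_zero] at hθF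
    simp only [hA, chart_zero]
    have hθP : IsPeriodicCfg (chart skewP (L * M) V θ) ((L : ℤ) * M) := by
      have h := isPeriodicCfg_chart skewP (L * M) hVP' θ
      rw [natCast_mul_period] at h
      exact h
    exact hmin _ (isUnitaryCfg_chart (L * M) hV θ) hθP hθ hθF
  -- Fermat along the restriction of `ψ`
  have hψP' : IsPeriodicDir ψ ((L * M : ℕ) : ℤ) := by rw [natCast_mul_period]; exact hψP
  have hker : (Q'.comp (fderiv ℝ (coord skewP L M V) 0)) (resDir (L * M) ψ) = 0 := by
    rw [ContinuousLinearMap.comp_apply]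
    have e : (fderiv ℝ (coord skewP L M V) 0) (resDir (L * M) ψ)
        = resDir M (fun y κ => pushDir L V ψ ((L : ℤ) • y) κ) := by
      funext r κ
      rw [fderiv_coord_apply skewP L M V hW, chartDir_skewP_resDir (L * M) hψP' hψs]
      rfl
    rw [e]
    exact hTc
  have hzero := fermat_of_submersion hloc hFd hAd hsurj hker
  have hder := hasDerivAt_fineAction_chartDir skewP (L * M) V Wf (resDir (L * M) ψ)
  rw [chartDir_skewP_resDir (L * M) hψP' hψs] at hder
  rw [show fderiv ℝ (fun ψ' : TDir d n (L * M) => fineAction (chart skewP (L * M) V ψ') Wf) 0 = fderiv ℝ A 0 from rfl,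
    hzero] at hder
  exact hder

/-- **R0 — FINE CRITICALITY OF CONSTRAINED MINIMISERS IN A SMALL-FIELD REGION.**  As `fineCritical_of_isLocalMin`, with
the side condition `Near U := |U(∂p) − 1| ≤ b` for some `b > a` (the small-field region in which Bałaban minimises;
`eventually_smallField_chart`): if `V` (period `L·M`, `|V(∂p) − 1| ≤ a`, `liftSmall d L·a ≤ 1`) minimises the fine Wilson
action of the period among the unitary `L·M`-periodic `U` with `|U(∂p) − 1| ≤ b` obeying `Q(cavg L U) = Q(cavg L V)`,
then `FineCritical L M V (Q′ ∘ res = 0)`. [cite: Balaban1985Variational, (75)–(77) p.289, (82)–(84) p.290, §E p.295] -/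
theorem fineCritical_of_isMinOn [Nonempty n] {L M : ℕ} [NeZero L] [NeZero M] {V : Site d → Fin d → 𝕄ˣ}
    (hV : IsUnitaryCfg V) (hVP : IsPeriodicCfg V ((L : ℤ) * M)) {a b : ℝ} (ha : 0 ≤ a) (hab : a < b)
    (hsmall : liftSmall d L * a ≤ 1) (hVa : SmallField V a)
    {G : Type*} [NormedAddCommGroup G] [NormedSpace ℝ G] [CompleteSpace G]
    (Q : (Site d → Fin d → 𝕄ˣ) → G) (Q' : TDir d n M →L[ℝ] G)
    (hQ : HasStrictFDerivAt (fun Φ : TDir d n M => Q (chart (ContinuousLinearMap.id ℝ 𝕄) M (cavg L V) Φ)) Q' 0)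
    (hQ' : ∀ γ : G, ∃ Φ : TDir d n M, (∀ r κ, Φ r κ ∈ skewAdjoint 𝕄) ∧ Q' Φ = γ)
    (hmin : ∀ U : Site d → Fin d → 𝕄ˣ, IsUnitaryCfg U → IsPeriodicCfg U ((L : ℤ) * M) → SmallField U b →
      Q (cavg L U) = Q (cavg L V) →
        fineAction V (blockWindow L (periodBox M)).2 ≤ fineAction U (blockWindow L (periodBox M)).2) :
    FineCritical L M V (fun φ => Q' (resDir M φ) = 0) := by
  have hVP' : IsPeriodicCfg V ((L * M : ℕ) : ℤ) := by rw [natCast_mul_period]; exact hVP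
  exact fineCritical_of_isLocalMin hV hVP ha hsmall hVa Q Q' hQ hQ' (fun U => SmallField U b)
    (eventually_smallField_chart skewP (L * M) hVP' hab hVa) hmin

/-! ## §4 R2ᴱ on the torus for ACTUAL constrained minimisers (gen 2's `dualResidual_torus` with R0 discharged) -/

/-- **R2ᴱ ON THE TORUS FOR CONSTRAINED MINIMISERS OF THE FINE WILSON ACTION** — `dualResidual_torus` with its
fine-criticality hypothesis DISCHARGED by `fineCritical_of_isMinOn`: for every `U(N)`-valued `V` of period `L·M` in the
small-field class (`liftSmall d L·a ≤ 1`) minimising the fine action of the period among unitary periodic configurations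
of the small-field region `b > a` under a constraint `Q(cavg L U) = Q(cavg L V)` imposed through the average (`Q` strictly
differentiable in the coarse chart with differential `Q′` onto from the `𝔲(N)` directions), every periodic coarse `𝔲(N)`
direction `φ` TANGENT TO THE CONSTRAINT (`Q′(res φ) = 0`), every coarse field `Φ` agreeing with `φ` at the block corners
and every derivative `D_c` at `0` of `s ↦ A^L_{[0,M)^d}(V̄ e^{sΦ})`:
`L^{d−4}|D_c| ≤ wallConst·[‖∇_VF‖_{ℓ²(period)}·dualC2·‖φ‖_{ℓ²} + a²·dualC1·‖φ‖_{ℓ¹}]`.  Dictionary: `V = U_{k+1}(V_top)`,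
`V̄ = W_k`, `D_c = ⟨J(W_k), φ⟩`, `φ ∈ T = ker DQ̄_k(W_k)` [cite: Balaban1985Variational, (26)–(27) p.282, §E p.295]. [folklore] -/
theorem dualResidual_minimiser [Nonempty n] {L M : ℕ} [NeZero L] [NeZero M] {V : Site d → Fin d → 𝕄ˣ}
    (hV : IsUnitaryCfg V) (hVP : IsPeriodicCfg V ((L : ℤ) * M)) {a b : ℝ} (ha : 0 ≤ a) (hab : a < b)
    (hsmall : liftSmall d L * a ≤ 1) (hVa : SmallField V a)
    {G : Type*} [NormedAddCommGroup G] [NormedSpace ℝ G] [CompleteSpace G]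
    (Q : (Site d → Fin d → 𝕄ˣ) → G) (Q' : TDir d n M →L[ℝ] G)
    (hQ : HasStrictFDerivAt (fun Φ : TDir d n M => Q (chart (ContinuousLinearMap.id ℝ 𝕄) M (cavg L V) Φ)) Q' 0)
    (hQ' : ∀ γ : G, ∃ Φ : TDir d n M, (∀ r κ, Φ r κ ∈ skewAdjoint 𝕄) ∧ Q' Φ = γ)
    (hmin : ∀ U : Site d → Fin d → 𝕄ˣ, IsUnitaryCfg U → IsPeriodicCfg U ((L : ℤ) * M) → SmallField U b →
      Q (cavg L U) = Q (cavg L V) →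
        fineAction V (blockWindow L (periodBox M)).2 ≤ fineAction U (blockWindow L (periodBox M)).2)
    (φ : Site d → Fin d → 𝕄) (hφs : ∀ (y : Site d) (κ : Fin d), φ y κ ∈ skewAdjoint 𝕄)
    (hφP : ∀ (y : Site d) (j κ : Fin d), φ (y + (M : ℤ) • e j) κ = φ y κ) (hφT : Q' (resDir M φ) = 0)
    (Φ : Site d → Fin d → 𝕄) (hΦ : ∀ (y : Site d) (κ : Fin d), Φ ((L : ℤ) • y) κ = φ y κ) {Dc : ℝ}
    (hDc : HasDerivAt (fun s : ℝ => coarseActionOf L (vary (bavg L V) Φ s) (blockWindow L (periodBox M)).1) Dc 0) :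
    (L : ℝ) ^ ((d : ℤ) - 4) * |Dc|
      ≤ wallConst d L * (Real.sqrt (gradFluxSq V (blockSites L (periodBox M))) * (dualC2 d L * Real.sqrt (coarseSq M φ))
          + a ^ 2 * (dualC1 d L * coarseL1 M φ)) :=
  dualResidual_torus (Nat.one_le_iff_ne_zero.mpr (NeZero.ne L)) (Nat.one_le_iff_ne_zero.mpr (NeZero.ne M)) hV hVP ha
    hsmall hVa (fineCritical_of_isMinOn hV hVP ha hab hsmall hVa Q Q' hQ hQ' hmin) φ hφs hφP hφT Φ hΦ hDc

/-- The dual-`ℓ²` form of `dualResidual_minimiser` (the shape `r ≤ ρ·√vol` of `T4ConvexResponse.actionRate_of_energyRoute`):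
`L^{d−4}|D_c| ≤ wallConst·[‖∇_VF‖_{ℓ²(period)}·dualC2 + a²·dualC1·√(d·M^d)]·‖φ‖_{ℓ²(period)}`. [folklore] -/
theorem dualResidual_minimiser_l2 [Nonempty n] {L M : ℕ} [NeZero L] [NeZero M] {V : Site d → Fin d → 𝕄ˣ}
    (hV : IsUnitaryCfg V) (hVP : IsPeriodicCfg V ((L : ℤ) * M)) {a b : ℝ} (ha : 0 ≤ a) (hab : a < b)
    (hsmall : liftSmall d L * a ≤ 1) (hVa : SmallField V a)
    {G : Type*} [NormedAddCommGroup G] [NormedSpace ℝ G] [CompleteSpace G]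
    (Q : (Site d → Fin d → 𝕄ˣ) → G) (Q' : TDir d n M →L[ℝ] G)
    (hQ : HasStrictFDerivAt (fun Φ : TDir d n M => Q (chart (ContinuousLinearMap.id ℝ 𝕄) M (cavg L V) Φ)) Q' 0)
    (hQ' : ∀ γ : G, ∃ Φ : TDir d n M, (∀ r κ, Φ r κ ∈ skewAdjoint 𝕄) ∧ Q' Φ = γ)
    (hmin : ∀ U : Site d → Fin d → 𝕄ˣ, IsUnitaryCfg U → IsPeriodicCfg U ((L : ℤ) * M) → SmallField U b →
      Q (cavg L U) = Q (cavg L V) →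
        fineAction V (blockWindow L (periodBox M)).2 ≤ fineAction U (blockWindow L (periodBox M)).2)
    (φ : Site d → Fin d → 𝕄) (hφs : ∀ (y : Site d) (κ : Fin d), φ y κ ∈ skewAdjoint 𝕄)
    (hφP : ∀ (y : Site d) (j κ : Fin d), φ (y + (M : ℤ) • e j) κ = φ y κ) (hφT : Q' (resDir M φ) = 0)
    (Φ : Site d → Fin d → 𝕄) (hΦ : ∀ (y : Site d) (κ : Fin d), Φ ((L : ℤ) • y) κ = φ y κ) {Dc : ℝ}
    (hDc : HasDerivAt (fun s : ℝ => coarseActionOf L (vary (bavg L V) Φ s) (blockWindow L (periodBox M)).1) Dc 0) :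
    (L : ℝ) ^ ((d : ℤ) - 4) * |Dc|
      ≤ wallConst d L * (Real.sqrt (gradFluxSq V (blockSites L (periodBox M))) * dualC2 d L
          + a ^ 2 * dualC1 d L * Real.sqrt ((d : ℝ) * (M : ℝ) ^ d)) * Real.sqrt (coarseSq M φ) :=
  dualResidual_torus_l2 (Nat.one_le_iff_ne_zero.mpr (NeZero.ne L)) (Nat.one_le_iff_ne_zero.mpr (NeZero.ne M)) hV hVP
    ha hsmall hVa (fineCritical_of_isMinOn hV hVP ha hab hsmall hVa Q Q' hQ hQ' hmin) φ hφs hφP hφT Φ hΦ hDc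

end

end Summit.QuantumFields.BalabanUV.T4Continuum.AveragingDeficitFermat
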